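import Summits.CriticalPhenomena.PercolationContinuityZ3.Theorems.PercNearOneGluingNoHeavyConstsMDLXJointAvoidedMarker
import HarnessLib

/-!
# J2 on the lattice of the avoided cluster's marker events — the two remaining corners `{y ↮ X} ∧ {z ↮ X}`, `{y ↮ X} ∨ {z ↮ X}`
# (PAPER-2 track (ii): constants of the CSH family; seat `prim-consts-2`, gen 12)

builds on p205010 (kernel theorem, internal audit signed; external expert review pending).  Support file (`--supports
stmt-CriticalPhenomena-4575`); memo `run/shared/lean/prim/consts/FROM-prim-consts-2-g12-EDGE-GIBBS.md` §1.  No definitions, no named facts,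
no sorries.  Companion of `…ConstsMDLXJointAvoidedMarker.lean` (`Consts.mdlxJ2_at_yAvoid`, `Consts.mdlxJ2_at_zAvoid`); notation as there:
`D = {s ↮ X}`, `T = {y ↮ {s}∪X} ∩ D`, `W = {y ↔ z}`, `Y = {s ↔ y}`, `Z = {s ↔ z}`, `A_y = {y ↮ X}`, `A_z = {z ↮ X}`, and J2 at an antitone
`g(C_X)` is `μ(T∩W)·[μ(D)μ(D∩{g}∩Y) − μ(D∩{g})μ(D∩Y)] ≤ μ(T)·[μ(D)μ(D∩{g}∩Z) − μ(D∩{g})μ(D∩Z)]` for an indicator `g`.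

* `Consts.mdlxJ2_at_yzAvoid` — `g = 1{y ↮ X}·1{z ↮ X}` (the avoided cluster swallows neither marker): the sum of `mdlxJ2_at_yAvoid`, of the
  `μ(D ∩ A_y ∖ A_z)`-multiple of `ν(s↔z) ≥ p'ν(s↔y)` (`Consts.mdlx_marker_reach_le`), and of a nonnegative term.
* `Consts.mdlxJ2_at_yOrZAvoid` — `g = 1{y ↮ X ∨ z ↮ X}`: the complement `D ∩ {y↔X} ∩ {z↔X}` meets neither `Y` nor `Z` inside `D`, so both
  brackets are multiples of its mass and the inequality is `Consts.mdlx_marker_reach_le`.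
With the companion's two theorems these are the four non-trivial antitone indicators of the lattice `{0,1}²` of the pair
`(1{y ∈ V(C_X)}, 1{z ∈ V(C_X)})`; J2 being linear in `g`, it holds for every functional of the avoided cluster that depends only on whether the
two markers are swallowed (layer cake) — the avoided-side mirror of `Consts.mdlxJoint_of_markerMeasurable`.
[cite: VandenbergHaggstromKahn2005, Thm. 1.3 (p. 6), Thm. 1.4 (p. 7) with Remark 1 after Thm. 1.2 (p. 5); Thm. 2.1 (p. 9)]
-/

noncomputable section

namespace Summit.CriticalPhenomena.PercolationContinuityZ3.Theorems

open MeasureTheory Set Literature.Probability.LatticeModels Literature.Probability.Percolation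
open scoped Classical

namespace Consts

variable {V : Type*} [Fintype V]

/-- **J2 at `g = 1{y ↮ X}·1{z ↮ X}`** (the avoided cluster swallows neither marker), measure form with
`A_{yz} = {y ↮ X} ∩ {z ↮ X}`.  `= mdlxJ2_at_yAvoid + μ(G_z ∖ G_y)`-multiple of `Consts.mdlx_marker_reach_le` `+` a nonnegative term
(`G_t = D ∩ {t ↔ X}`). [cite: VandenbergHaggstromKahn2005, Thm. 1.3 (p. 6), Thm. 1.4 (p. 7) — corollary, derived here] -/
theorem mdlxJ2_at_yzAvoid (w : Sym2 V → unitInterval) (s y z : V) (X : Set V) :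
    (prodBernoulli w).real ({ω : BondConfig V | ∀ x ∈ insert s X, ¬ (openGraph ω).Reachable y x} ∩
        {ω | ∀ x ∈ X, ¬ (openGraph ω).Reachable s x} ∩ openConn y z) *
      ((prodBernoulli w).real {ω : BondConfig V | ∀ x ∈ X, ¬ (openGraph ω).Reachable s x} *
          (prodBernoulli w).real ({ω : BondConfig V | ∀ x ∈ X, ¬ (openGraph ω).Reachable s x} ∩
            ({ω | ∀ x ∈ X, ¬ (openGraph ω).Reachable y x} ∩ {ω | ∀ x ∈ X, ¬ (openGraph ω).Reachable z x}) ∩ openConn s y) -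
        (prodBernoulli w).real ({ω : BondConfig V | ∀ x ∈ X, ¬ (openGraph ω).Reachable s x} ∩
            ({ω | ∀ x ∈ X, ¬ (openGraph ω).Reachable y x} ∩ {ω | ∀ x ∈ X, ¬ (openGraph ω).Reachable z x})) *
          (prodBernoulli w).real ({ω : BondConfig V | ∀ x ∈ X, ¬ (openGraph ω).Reachable s x} ∩ openConn s y)) ≤
    (prodBernoulli w).real ({ω : BondConfig V | ∀ x ∈ insert s X, ¬ (openGraph ω).Reachable y x} ∩
        {ω | ∀ x ∈ X, ¬ (openGraph ω).Reachable s x}) *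
      ((prodBernoulli w).real {ω : BondConfig V | ∀ x ∈ X, ¬ (openGraph ω).Reachable s x} *
          (prodBernoulli w).real ({ω : BondConfig V | ∀ x ∈ X, ¬ (openGraph ω).Reachable s x} ∩
            ({ω | ∀ x ∈ X, ¬ (openGraph ω).Reachable y x} ∩ {ω | ∀ x ∈ X, ¬ (openGraph ω).Reachable z x}) ∩ openConn s z) -
        (prodBernoulli w).real ({ω : BondConfig V | ∀ x ∈ X, ¬ (openGraph ω).Reachable s x} ∩
            ({ω | ∀ x ∈ X, ¬ (openGraph ω).Reachable y x} ∩ {ω | ∀ x ∈ X, ¬ (openGraph ω).Reachable z x})) *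
          (prodBernoulli w).real ({ω : BondConfig V | ∀ x ∈ X, ¬ (openGraph ω).Reachable s x} ∩ openConn s z)) := by
  classical
  set μ := prodBernoulli w with hμ
  have hmeas : ∀ S : Set (BondConfig V), MeasurableSet S := fun _ => MeasurableSet.of_discrete
  set D : Set (BondConfig V) := {ω | ∀ x ∈ X, ¬ (openGraph ω).Reachable s x} with hD
  set A : Set (BondConfig V) := {ω | ∀ x ∈ insert s X, ¬ (openGraph ω).Reachable y x} with hA
  set Ay : Set (BondConfig V) := {ω | ∀ x ∈ X, ¬ (openGraph ω).Reachable y x} with hAy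
  set Az : Set (BondConfig V) := {ω | ∀ x ∈ X, ¬ (openGraph ω).Reachable z x} with hAz
  set Yv : Set (BondConfig V) := openConn s y with hYv
  set Zv : Set (BondConfig V) := openConn s z with hZv
  set Wv : Set (BondConfig V) := openConn y z with hWv
  have keyY := mdlxJ2_at_yAvoid w s y z X
  change μ.real (A ∩ D ∩ Wv) * (μ.real D * μ.real (D ∩ Ay ∩ Yv) - μ.real (D ∩ Ay) * μ.real (D ∩ Yv)) ≤
    μ.real (A ∩ D) * (μ.real D * μ.real (D ∩ Ay ∩ Zv) - μ.real (D ∩ Ay) * μ.real (D ∩ Zv)) at keyY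
  have keyM := mdlx_marker_reach_le w s y z X
  change μ.real (A ∩ D ∩ Wv) * μ.real (D ∩ Yv) ≤ μ.real (A ∩ D) * μ.real (D ∩ Zv) at keyM
  have mD : ∀ ω, ω ∈ D ↔ ∀ x ∈ X, ¬ (openGraph ω).Reachable s x := fun ω => Iff.rfl
  have mAy : ∀ ω, ω ∈ Ay ↔ ∀ x ∈ X, ¬ (openGraph ω).Reachable y x := fun ω => Iff.rfl
  have mAz : ∀ ω, ω ∈ Az ↔ ∀ x ∈ X, ¬ (openGraph ω).Reachable z x := fun ω => Iff.rfl
  -- pieces: `P = D ∩ Ay ∩ Az`, `Q = D ∩ Ay ∖ Az`; `D ∩ Ay = P ⊔ Q`; `D ∩ Ay ∩ Z = P ∩ Z` (as `Z ⊆ Az` in `D`); `D ∩ Y ⊆ Ay`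
  set P : Set (BondConfig V) := D ∩ (Ay ∩ Az) with hP
  set Q : Set (BondConfig V) := (D ∩ Ay) \ Az with hQ
  have ePQ : μ.real P + μ.real Q = μ.real (D ∩ Ay) := by
    have h := measureReal_inter_add_sdiff (μ := μ) (s := D ∩ Ay) (hmeas Az)
    rwa [inter_assoc] at h
  have sPZ : P ∩ Zv = D ∩ Ay ∩ Zv := by
    ext ω; simp only [hP, mem_inter_iff, mD, mAy, mAz]
    constructor
    · rintro ⟨⟨hD', hy, -⟩, hz⟩; exact ⟨⟨hD', hy⟩, hz⟩
    · rintro ⟨⟨hD', hy⟩, hz⟩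
      exact ⟨⟨hD', hy, fun x hx hr => hD' x hx ((show (openGraph ω).Reachable s z from hz).trans hr)⟩, hz⟩
  have ePQY : μ.real (P ∩ Yv) + μ.real (Q ∩ Yv) = μ.real (D ∩ Ay ∩ Yv) := by
    have h := measureReal_inter_add_sdiff (μ := μ) (s := D ∩ Ay ∩ Yv) (hmeas Az)
    have e1 : D ∩ Ay ∩ Yv ∩ Az = P ∩ Yv := by
      rw [hP, inter_right_comm, ← inter_assoc]
    have e2 : (D ∩ Ay ∩ Yv) \ Az = Q ∩ Yv := by
      ext ω; simp only [hQ, mem_sdiff, mem_inter_iff]; tauto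
    rwa [e1, e2] at h
  have sDY : D ∩ Ay ∩ Yv = D ∩ Yv := by
    ext ω; simp only [mem_inter_iff, mD, mAy]
    constructor
    · rintro ⟨⟨hD', -⟩, hy⟩; exact ⟨hD', hy⟩
    · rintro ⟨hD', hy⟩
      exact ⟨⟨hD', fun x hx hr => hD' x hx ((show (openGraph ω).Reachable s y from hy).trans hr)⟩, hy⟩
  have hQY : μ.real (Q ∩ Yv) ≤ μ.real Q := measureReal_mono inter_subset_left
  have hPZ : μ.real (P ∩ Zv) ≤ μ.real (D ∩ Zv) := by
    rw [sPZ]; exact measureReal_mono fun ω hω => ⟨hω.1.1, hω.2⟩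
  rw [sPZ]
  rw [sDY] at keyY ePQY
  have h0 : ∀ S : Set (BondConfig V), 0 ≤ μ.real S := fun _ => measureReal_nonneg
  -- express everything through `μ(D∩Ay) = μP + μQ`, `μ(D∩Y) = μ(P∩Y) + μ(Q∩Y)`
  have e1 : μ.real D * μ.real (P ∩ Yv) - μ.real P * μ.real (D ∩ Yv) =
      (μ.real D * μ.real (D ∩ Yv) - μ.real (D ∩ Ay) * μ.real (D ∩ Yv)) +
        (μ.real Q * μ.real (D ∩ Yv) - μ.real D * μ.real (Q ∩ Yv)) := by
    rw [← ePQ, ← ePQY]; ring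
  have e2 : μ.real D * μ.real (D ∩ Ay ∩ Zv) - μ.real P * μ.real (D ∩ Zv) =
      (μ.real D * μ.real (D ∩ Ay ∩ Zv) - μ.real (D ∩ Ay) * μ.real (D ∩ Zv)) + μ.real Q * μ.real (D ∩ Zv) := by
    rw [← ePQ]; ring
  rw [e1, e2, mul_add, mul_add]
  have h3 : μ.real (A ∩ D ∩ Wv) * (μ.real Q * μ.real (D ∩ Yv) - μ.real D * μ.real (Q ∩ Yv)) ≤
      μ.real (A ∩ D) * (μ.real Q * μ.real (D ∩ Zv)) := by
    have hA := mul_le_mul_of_nonneg_left keyM (h0 Q)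
    have hB := mul_nonneg (h0 (A ∩ D ∩ Wv)) (mul_nonneg (h0 D) (h0 (Q ∩ Yv)))
    calc μ.real (A ∩ D ∩ Wv) * (μ.real Q * μ.real (D ∩ Yv) - μ.real D * μ.real (Q ∩ Yv))
          = μ.real Q * (μ.real (A ∩ D ∩ Wv) * μ.real (D ∩ Yv)) - μ.real (A ∩ D ∩ Wv) * (μ.real D * μ.real (Q ∩ Yv)) := by
            ring
      _ ≤ μ.real Q * (μ.real (A ∩ D) * μ.real (D ∩ Zv)) - 0 := by linarith [hA, hB]
      _ = μ.real (A ∩ D) * (μ.real Q * μ.real (D ∩ Zv)) := by ring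
  linarith [keyY, h3]

/-- **J2 at `g = 1{y ↮ X ∨ z ↮ X}`** (the avoided cluster does not swallow both markers), measure form with
`A_{y∨z} = {y ↮ X} ∪ {z ↮ X}`.  Its complement `G_y ∩ G_z` meets neither `Y` nor `Z` inside `D`, so both brackets are
`μ(D ∩ G_y ∩ G_z)`-multiples and the inequality is `Consts.mdlx_marker_reach_le`.
[cite: VandenbergHaggstromKahn2005, Thm. 1.3 (p. 6), Thm. 1.4 (p. 7) — corollary, derived here] -/
theorem mdlxJ2_at_yOrZAvoid (w : Sym2 V → unitInterval) (s y z : V) (X : Set V) :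
    (prodBernoulli w).real ({ω : BondConfig V | ∀ x ∈ insert s X, ¬ (openGraph ω).Reachable y x} ∩
        {ω | ∀ x ∈ X, ¬ (openGraph ω).Reachable s x} ∩ openConn y z) *
      ((prodBernoulli w).real {ω : BondConfig V | ∀ x ∈ X, ¬ (openGraph ω).Reachable s x} *
          (prodBernoulli w).real ({ω : BondConfig V | ∀ x ∈ X, ¬ (openGraph ω).Reachable s x} ∩
            ({ω | ∀ x ∈ X, ¬ (openGraph ω).Reachable y x} ∪ {ω | ∀ x ∈ X, ¬ (openGraph ω).Reachable z x}) ∩ openConn s y) -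
        (prodBernoulli w).real ({ω : BondConfig V | ∀ x ∈ X, ¬ (openGraph ω).Reachable s x} ∩
            ({ω | ∀ x ∈ X, ¬ (openGraph ω).Reachable y x} ∪ {ω | ∀ x ∈ X, ¬ (openGraph ω).Reachable z x})) *
          (prodBernoulli w).real ({ω : BondConfig V | ∀ x ∈ X, ¬ (openGraph ω).Reachable s x} ∩ openConn s y)) ≤
    (prodBernoulli w).real ({ω : BondConfig V | ∀ x ∈ insert s X, ¬ (openGraph ω).Reachable y x} ∩
        {ω | ∀ x ∈ X, ¬ (openGraph ω).Reachable s x}) *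
      ((prodBernoulli w).real {ω : BondConfig V | ∀ x ∈ X, ¬ (openGraph ω).Reachable s x} *
          (prodBernoulli w).real ({ω : BondConfig V | ∀ x ∈ X, ¬ (openGraph ω).Reachable s x} ∩
            ({ω | ∀ x ∈ X, ¬ (openGraph ω).Reachable y x} ∪ {ω | ∀ x ∈ X, ¬ (openGraph ω).Reachable z x}) ∩ openConn s z) -
        (prodBernoulli w).real ({ω : BondConfig V | ∀ x ∈ X, ¬ (openGraph ω).Reachable s x} ∩
            ({ω | ∀ x ∈ X, ¬ (openGraph ω).Reachable y x} ∪ {ω | ∀ x ∈ X, ¬ (openGraph ω).Reachable z x})) *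
          (prodBernoulli w).real ({ω : BondConfig V | ∀ x ∈ X, ¬ (openGraph ω).Reachable s x} ∩ openConn s z)) := by
  classical
  set μ := prodBernoulli w with hμ
  have hmeas : ∀ S : Set (BondConfig V), MeasurableSet S := fun _ => MeasurableSet.of_discrete
  set D : Set (BondConfig V) := {ω | ∀ x ∈ X, ¬ (openGraph ω).Reachable s x} with hD
  set A : Set (BondConfig V) := {ω | ∀ x ∈ insert s X, ¬ (openGraph ω).Reachable y x} with hA
  set Ay : Set (BondConfig V) := {ω | ∀ x ∈ X, ¬ (openGraph ω).Reachable y x} with hAy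
  set Az : Set (BondConfig V) := {ω | ∀ x ∈ X, ¬ (openGraph ω).Reachable z x} with hAz
  set Yv : Set (BondConfig V) := openConn s y with hYv
  set Zv : Set (BondConfig V) := openConn s z with hZv
  set Wv : Set (BondConfig V) := openConn y z with hWv
  have keyM := mdlx_marker_reach_le w s y z X
  change μ.real (A ∩ D ∩ Wv) * μ.real (D ∩ Yv) ≤ μ.real (A ∩ D) * μ.real (D ∩ Zv) at keyM
  have mD : ∀ ω, ω ∈ D ↔ ∀ x ∈ X, ¬ (openGraph ω).Reachable s x := fun ω => Iff.rfl
  have mAy : ∀ ω, ω ∈ Ay ↔ ∀ x ∈ X, ¬ (openGraph ω).Reachable y x := fun ω => Iff.rfl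
  have mAz : ∀ ω, ω ∈ Az ↔ ∀ x ∈ X, ¬ (openGraph ω).Reachable z x := fun ω => Iff.rfl
  set Gyz : Set (BondConfig V) := D \ (Ay ∪ Az) with hGyz
  have eD : μ.real (D ∩ (Ay ∪ Az)) + μ.real Gyz = μ.real D :=
    measureReal_inter_add_sdiff (μ := μ) (s := D) ((hmeas Ay).union (hmeas Az))
  have sY : D ∩ (Ay ∪ Az) ∩ Yv = D ∩ Yv := by
    ext ω; simp only [mem_inter_iff, mem_union, mD, mAy, mAz]
    constructor
    · rintro ⟨⟨hD', -⟩, hy⟩; exact ⟨hD', hy⟩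
    · rintro ⟨hD', hy⟩
      exact ⟨⟨hD', Or.inl fun x hx hr => hD' x hx ((show (openGraph ω).Reachable s y from hy).trans hr)⟩, hy⟩
  have sZ : D ∩ (Ay ∪ Az) ∩ Zv = D ∩ Zv := by
    ext ω; simp only [mem_inter_iff, mem_union, mD, mAy, mAz]
    constructor
    · rintro ⟨⟨hD', -⟩, hz⟩; exact ⟨hD', hz⟩
    · rintro ⟨hD', hz⟩
      exact ⟨⟨hD', Or.inr fun x hx hr => hD' x hx ((show (openGraph ω).Reachable s z from hz).trans hr)⟩, hz⟩
  rw [sY, sZ]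
  have h0 : ∀ S : Set (BondConfig V), 0 ≤ μ.real S := fun _ => measureReal_nonneg
  have e1 : μ.real D * μ.real (D ∩ Yv) - μ.real (D ∩ (Ay ∪ Az)) * μ.real (D ∩ Yv) = μ.real Gyz * μ.real (D ∩ Yv) := by
    rw [← eD]; ring
  have e2 : μ.real D * μ.real (D ∩ Zv) - μ.real (D ∩ (Ay ∪ Az)) * μ.real (D ∩ Zv) = μ.real Gyz * μ.real (D ∩ Zv) := by
    rw [← eD]; ring
  rw [e1, e2]
  nlinarith [mul_le_mul_of_nonneg_left keyM (h0 Gyz)]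

end Consts

end Summit.CriticalPhenomena.PercolationContinuityZ3.Theorems

end
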